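import Literature.NumberTheory.Rogawski1990.ArchHcJumpTwoChartOrbital             -- ★ (F0P3a-p08 (g23)): `…_of_twoChart_orbital`; brings ★ 2b p851048 (abstract readers) and ★ p851143 ∕ p851042 ∕ p851003 (B-par)
import HarnessLib

/-!
# (I₃) ADAPTED WORDS WITH THE STABLE (ODD-ISED) COMPACT READER: ★ 2b-orbital with `hdesc₁` reading `Φ₁(g)(ν) − Φ₁(g)(−ν)` — the shape of the STABLE family `stOrbFamH` of `H_∞`
# (Shelstad 1979 §4 (II), Lemma 4.3, Prop. 4.5, Thm. 4.7 (IIIb): `Ψ^{T,1}_f = Σ_w Φ^w_f`; Bouaziz 1994 §3.2 (I₃), §6.2; Varadarajan 1977 I §1.12)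

Topic `NumberTheory/Rogawski1990`; namespace `Literature.NumberTheory.Rogawski1990`.  THEOREMS ONLY (no `def`, no instance, no notation, no axiom, no named fact, no `sorry`);
kernel lane `--kind proof --supports stmt-HodgeConjecture-24833`.  Cell `pub/hodgecm-mathlib`, crux H413 (`stmt-HodgeConjecture-24833`), F0∕P3c line LH3 (closer stub `stub_N9`,
leaf `F0_P3c_StubN9Direct`), letter L3′ forward half = the jump clause (J) of `ArchBouazizSpaceH jcH (stOrbFamH L νH fH)` for a GENERAL `fH`; brick **(JH-st-2)** of
`F0/P3c/LH3/LH3-p01/g5/JH-SPEC.v2.md` (LH3-p01 (g5), JH binder of record); consumer (JH-asm) (LH3-p03 (g6)).  Count-neutral.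

WHY.  On the compact chart `S` (`w₀ ∉ S`) the STABLE family is the sum over the flips `T ⊆ Sᶜ` of the chart orbital functional (★ `exists_placeLeaves_stOrbFamH_model` (c)); the flips
containing `w₀` read the rank-one elliptic reader `Φ₁` at `−ν` (the other element `t_1(−ψ)` of the stable class), so the compact-chart descent identity of `e^{ρ}·stOrbFamH S` has the
ODD-ISED reader `Φ₁(g)(ν) − Φ₁(g)(−ν)` where ★ 2b-orbital (the `G′`-side, ONE class) has `Φ₁(g)(ν)`.  ★ 2b (p851048) is abstract in the reader, so the same five analytic sockets
discharge: `h1₁ ∕ h2₁` for the odd-ised reader follow from ★ p851143 composed with the linear involution `(q, ψ) ↦ (q, −ψ)` (which preserves `univ ×ˢ {sin ψ ≠ 0}` and fixes the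
transversal direction `(v, 0)`); `h1₂ ∕ h2₂ ∕ hcl` are unchanged.  The junction `hjump` is then asked for the odd-ised family — supplied by ★ (JH-st-1)
`exists_hasOneSidedJump_iteratedDeriv_allOrders_chart_stable_of_eq_over` with `κ := 2κ₀`.

THE STATEMENT (`hasOneSidedJump_iteratedFDeriv_adaptedWord_of_twoChart_orbital_stable`): ★ `…_of_twoChart_orbital` VERBATIM except (i) `hdesc₁` reads
`F₁ c = K₁ * (ce (ν c) * Pf (π c) - Ef (π c)) * (Φ₁ (g (π c)) (ν c) - Φ₁ (g (π c)) (-(ν c)))` and (ii) `hjump` reads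
`HasOneSidedJump (fun t => iteratedDeriv a (fun t => Φ₁ (g' p) t - Φ₁ (g' p) (-t)) t) (κ * I ^ a * iteratedDeriv a (Φ₂ (g' p)) 0)`.
HONEST LABEL: a junction by `refine`; count-neutral; HC_CM is proved only modulo the 7 printed citations (2 remaining: hLiu418 = stmt-HodgeConjecture-24832, h413 =
stmt-HodgeConjecture-24833) until rung 0 closes.

## References
* [Varadarajan1977] V. S. Varadarajan, *Harmonic Analysis on Real Reductive Groups*, LNM 576 (1977), Part I §1.12.
* [Shelstad1979] D. Shelstad, *Characters and inner forms of a quasi-split group over ℝ*, Compositio Math. 39 (1979), §4 (II) p. 23, Lemma 4.3 p. 25, Prop. 4.5 p. 26, Thm. 4.7 (IIIb) p. 31.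
* [Bouaziz1994IntegralesOrbitales] A. Bouaziz, *Intégrales orbitales sur les groupes de Lie réductifs*, Ann. Sci. ÉNS 27 (1994), §3.2 (I₃) p. 580, §6.2 p. 591.
* [HormanderALPDO1] L. Hörmander, *The Analysis of Linear Partial Differential Operators I*, 2nd ed. (1990), §1.1 Thm. 1.1.8–1.1.9.
-/

set_option autoImplicit false

noncomputable section

open Set Filter Function Complex MeasureTheory
open scoped Topology ContDiff MatrixGroups Matrix.Norms.Operator
open Literature.NumberTheory.Automorphic Literature.NumberTheory.Automorphic.UnitaryGroup
open Literature.NumberTheory.Automorphic.Shelstad1979.StableOrbitalIntegrals Literature.Analysis.Calculus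

namespace Literature.NumberTheory.Rogawski1990

variable {W : Type*} [Fintype W] [DecidableEq W]

/-- **(I₃) FOR ADAPTED WORDS — ★ 2b WITH THE (B-par) READERS PLUGGED, STABLE (ODD-ISED) COMPACT READER.**  As ★ `hasOneSidedJump_iteratedFDeriv_adaptedWord_of_twoChart_orbital`
(same carrier `U(J)`, same reader tokens `hΦ₁ ∕ hΦ₂`, same admissible class, cofactor data, wall point, `hdesc₂`), but the compact-chart identity `hdesc₁` reads the ODD-ISED reader
`Φ₁(g (π c))(ν c) − Φ₁(g (π c))(−ν c)` and the junction `hjump` is asked for the odd-ised family; THEN every adapted-word jet of `F₁` along the normal ray jumps by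
`(K₁∕K₂)·κ · hcCayScalar w i m ·` the Cayley-word jet of `F₂`. [cite: Varadarajan1977, I §1.12] [cite: Shelstad1979, §4 (II) p. 23; Lemma 4.3 (p. 25); Prop. 4.5 (p. 26); Thm. 4.7 (IIIb) p. 31]
[cite: Bouaziz1994IntegralesOrbitales, §3.2 (I₃) p. 580; §6.2 p. 591] -/
theorem hasOneSidedJump_iteratedFDeriv_adaptedWord_of_twoChart_orbital_stable (w : W) {i j : Fin 3} (hij : i ≠ j)
    {J : Matrix (Fin 2) (Fin 2) ℂ} (hJ : J = (StdForm.antidiagonal 2).over ℂ)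
    [MeasurableSpace ↥(unitaryGroupOfForm (starRingEnd ℂ) J)] [BorelSpace ↥(unitaryGroupOfForm (starRingEnd ℂ) J)]
    (μ : Measure ↥(unitaryGroupOfForm (starRingEnd ℂ) J)) [IsFiniteMeasureOnCompacts μ] (z : Circle)
    (Φ₁ : (Matrix (Fin 2) (Fin 2) ℂ → ℂ) → ℝ → ℂ)
    (hΦ₁ : ∀ (f : Matrix (Fin 2) (Fin 2) ℂ → ℂ) (ψ : ℝ), Φ₁ f ψ = (2 * Real.sin ψ) •
      ∫ h : ↥(unitaryGroupOfForm (starRingEnd ℂ) J),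
        f (((h * ⟨Matrix.GeneralLinearGroup.mkOfDetNeZero !![(1 : ℂ), 1; 1, -1] det_cayleyTwo_ne_zero *
              circleDiagonal 2 ![z * Circle.exp ψ, z * Circle.exp (-ψ)] * (Matrix.GeneralLinearGroup.mkOfDetNeZero !![(1 : ℂ), 1; 1, -1] det_cayleyTwo_ne_zero)⁻¹,
            cayley_conj_circleDiagonal_mem_of_eq_over hJ _⟩ * h⁻¹ : ↥(unitaryGroupOfForm (starRingEnd ℂ) J)) : GL (Fin 2) ℂ) : Matrix (Fin 2) (Fin 2) ℂ) ∂μ)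
    {K : Subgroup ↥(unitaryGroupOfForm (starRingEnd ℂ) J)} (κK : Measure ↥K) (μN : Measure ↥(unipotentU (starRingEnd ℂ) J))
    (hK : IsCompact (K : Set ↥(unitaryGroupOfForm (starRingEnd ℂ) J))) [κK.IsHaarMeasure] [μN.IsHaarMeasure] (θ : ℝ)
    (Φ₂ : (Matrix (Fin 2) (Fin 2) ℂ → ℂ) → ℝ → ℂ)
    (hΦ₂ : ∀ (f : Matrix (Fin 2) (Fin 2) ℂ → ℂ) (x : ℝ), Φ₂ f x = ∫ p : ↥K × ↥(unipotentU (starRingEnd ℂ) J), f ((((((p.1 : ↥K) : ↥(unitaryGroupOfForm (starRingEnd ℂ) J)) * (((⟨hypBlockGL 0 θ, hypBlockGL_mem_of_eq_over hJ 0 θ⟩ : ↥(unitaryGroupOfForm (starRingEnd ℂ) J))) * ((⟨hypBlockGL (x / 2) 0, hypBlockGL_mem_of_eq_over hJ (x / 2) 0⟩ : ↥(unitaryGroupOfForm (starRingEnd ℂ) J))) * ((p.2 : ↥(unipotentU (starRingEnd ℂ) J)) : ↥(unitaryGroupOfForm (starRingEnd ℂ) J)) * ((⟨hypBlockGL (x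 / 2) 0, hypBlockGL_mem_of_eq_over hJ (x / 2) 0⟩ : ↥(unitaryGroupOfForm (starRingEnd ℂ) J)))) * ((p.1 : ↥K) : ↥(unitaryGroupOfForm (starRingEnd ℂ) J))⁻¹ : ↥(unitaryGroupOfForm (starRingEnd ℂ) J))) : GL (Fin 2) ℂ) : Matrix (Fin 2) (Fin 2) ℂ) ∂(κK.prod μN))
    {T₁ : Set ℝ} (hT₁ : IsOpen T₁) (hT₁s : T₁ ⊆ {ψ : ℝ | Real.sin ψ ≠ 0}) (hray : ∀ᶠ t : ℝ in 𝓝[≠] 0, t ∈ T₁)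
    {Q : Set (W → Fin 3 → ℝ)} (hQ : IsOpen Q)
    (g : (W → Fin 3 → ℝ) → Matrix (Fin 2) (Fin 2) ℂ → ℂ) (hg : ContDiff ℝ ∞ (Function.uncurry g))
    (hgc : ∃ C : Set (Matrix (Fin 2) (Fin 2) ℂ), IsCompact C ∧ ∀ (q : W → Fin 3 → ℝ) (X : Matrix (Fin 2) (Fin 2) ℂ), X ∉ C → g q X = 0)
    (Pf Ef : (W → Fin 3 → ℝ) → ℂ) (hPf : ContDiffOn ℝ ∞ Pf Q) (hEf : ContDiffOn ℝ ∞ Ef Q)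
    (ce ch : ℝ → ℂ) (hce : ContDiff ℝ ∞ ce) (hch : ContDiff ℝ ∞ ch) (hwick : ∀ a : ℕ, iteratedDeriv a ce 0 = I ^ a * iteratedDeriv a ch 0)
    (K₁ K₂ κ : ℂ) (hK₂ : K₂ ≠ 0)
    {p : W → Fin 3 → ℝ} (hp : p w i = p w j) (hpQ : p ∈ Q)
    (F₁ F₂ : (W → Fin 3 → ℝ) → ℂ) {U₁ U₂ : Set (W → Fin 3 → ℝ)} (hU₁ : IsOpen U₁) (hpU₁ : p ∈ U₁) (hU₂ : IsOpen U₂) (hpU₂ : hcCayPt w i j p ∈ U₂)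
    (hdesc₁ : ∀ c ∈ U₁, (c w i - c w j) / 2 ∈ T₁ →
      F₁ c = K₁ * (ce ((c w i - c w j) / 2) * Pf (c - ((c w i - c w j) / 2) • hcNrm w i j) - Ef (c - ((c w i - c w j) / 2) • hcNrm w i j)) *
        (Φ₁ (g (c - ((c w i - c w j) / 2) • hcNrm w i j)) ((c w i - c w j) / 2) - Φ₁ (g (c - ((c w i - c w j) / 2) • hcNrm w i j)) (-((c w i - c w j) / 2))))
    (hdesc₂ : ∀ c ∈ U₂,
      F₂ c = K₂ * (ch (c w 0) * Pf (Function.update c w (fun s => if s = hcThird i j then c w 1 else c w 2)) -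
          Ef (Function.update c w (fun s => if s = hcThird i j then c w 1 else c w 2))) *
        Φ₂ (g (Function.update c w (fun s => if s = hcThird i j then c w 1 else c w 2))) (c w 0))
    (hjump : ∀ g' : (W → Fin 3 → ℝ) → Matrix (Fin 2) (Fin 2) ℂ → ℂ,
      (ContDiff ℝ ∞ (Function.uncurry g') ∧ ∃ C : Set (Matrix (Fin 2) (Fin 2) ℂ), IsCompact C ∧ ∀ (q : W → Fin 3 → ℝ) (X : Matrix (Fin 2) (Fin 2) ℂ), X ∉ C → g' q X = 0) →
      ∀ a : ℕ, HasOneSidedJump (fun t : ℝ => iteratedDeriv a (fun t : ℝ => Φ₁ (g' p) t - Φ₁ (g' p) (-t)) t) (κ * I ^ a * iteratedDeriv a (Φ₂ (g' p)) 0))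
    (n : ℕ) (m : Fin n → W × Fin 3) :
    HasOneSidedJump (fun ν : ℝ => iteratedFDeriv ℝ n F₁ (p + ν • hcNrm w i j) (fun r => hcAdaptedVec w i j (m r)))
      (K₁ / K₂ * κ * hcCayScalar w i m * iteratedFDeriv ℝ n F₂ (hcCayPt w i j p) (fun r => hcCayVec w i j (m r))) := by
  -- the odd-ised reader and the linear involution `(q, ψ) ↦ (q, −ψ)`
  have hopen : IsOpen ((Set.univ : Set (W → Fin 3 → ℝ)) ×ˢ {ψ : ℝ | Real.sin ψ ≠ 0}) :=
    isOpen_univ.prod (isOpen_ne_fun Real.continuous_sin continuous_const)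
  have hnegmem : ∀ {ψ : ℝ}, Real.sin ψ ≠ 0 → Real.sin (-ψ) ≠ 0 := fun hψ => by rwa [Real.sin_neg, neg_ne_zero]
  have hN : ∀ z : (W → Fin 3 → ℝ) × ℝ, HasFDerivAt (fun z : (W → Fin 3 → ℝ) × ℝ => (z.1, -z.2))
      ((ContinuousLinearMap.fst ℝ (W → Fin 3 → ℝ) ℝ).prod (-(ContinuousLinearMap.snd ℝ (W → Fin 3 → ℝ) ℝ))) z := fun z =>
    (ContinuousLinearMap.fst ℝ (W → Fin 3 → ℝ) ℝ).hasFDerivAt.prodMk (ContinuousLinearMap.snd ℝ (W → Fin 3 → ℝ) ℝ).hasFDerivAt.neg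
  have hNsmooth : ContDiff ℝ ∞ (fun z : (W → Fin 3 → ℝ) × ℝ => (z.1, -z.2)) := contDiff_fst.prodMk contDiff_snd.neg
  refine hasOneSidedJump_iteratedFDeriv_adaptedWord_of_twoChart w hij (fun f ψ => Φ₁ f ψ - Φ₁ f (-ψ)) Φ₂ hT₁ hray
    (fun g' : (W → Fin 3 → ℝ) → Matrix (Fin 2) (Fin 2) ℂ → ℂ =>
      ContDiff ℝ ∞ (Function.uncurry g') ∧ ∃ C : Set (Matrix (Fin 2) (Fin 2) ℂ), IsCompact C ∧ ∀ (q : W → Fin 3 → ℝ) (X : Matrix (Fin 2) (Fin 2) ℂ), X ∉ C → g' q X = 0)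
    (fun (v : W → Fin 3 → ℝ) (g' : (W → Fin 3 → ℝ) → Matrix (Fin 2) (Fin 2) ℂ → ℂ) => fun q X => fderiv ℝ (fun q' : W → Fin 3 → ℝ => g' q' X) q v)
    ?_ hQ ?_ ?_ ?_ ?_ g ⟨hg, hgc⟩ Pf Ef hPf hEf ce ch hce hch hwick K₁ K₂ κ hK₂ hp hpQ F₁ F₂ hU₁ hpU₁ hU₂ hpU₂ hdesc₁ hdesc₂ hjump n m
  · -- `hcl`: the class is closed under `D v` (★ p851003)
    rintro g' ⟨hg', C, hC, h0⟩ v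
    exact ⟨contDiff_uncurry_fderiv_apply hg' v, C, hC, forall_fderiv_apply_eq_zero_of_support h0 v⟩
  · -- `h1₁`: joint smoothness of the odd-ised elliptic reader on `Q ×ˢ T₁` (★ p851143 and its pull-back under the involution)
    rintro g' ⟨hg', hgc'⟩
    have h := contDiffOn_cayley_orbitalIntegral_param hJ μ z Φ₁ hΦ₁ g' hg' hgc'
    have h' : ContDiffOn ℝ ∞ (fun x : (W → Fin 3 → ℝ) × ℝ => Φ₁ (g' x.1) (-x.2)) ((Set.univ : Set (W → Fin 3 → ℝ)) ×ˢ {ψ : ℝ | Real.sin ψ ≠ 0}) :=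
      h.comp hNsmooth.contDiffOn fun x hx => ⟨Set.mem_univ _, hnegmem (Set.mem_prod.1 hx).2⟩
    exact (h.sub h').mono (Set.prod_mono (Set.subset_univ _) hT₁s)
  · -- `h2₁`: the odd-ised reader differentiates its family in the transversal direction `(v, 0)` (★ p851143 at `(q, ψ)` and at `(q, −ψ)`)
    rintro g' ⟨hg', hgc'⟩ v x hx
    have hx2 : Real.sin x.2 ≠ 0 := hT₁s (Set.mem_prod.1 hx).2
    have h := contDiffOn_cayley_orbitalIntegral_param hJ μ z Φ₁ hΦ₁ g' hg' hgc'
    have hd1 : DifferentiableAt ℝ (fun y : (W → Fin 3 → ℝ) × ℝ => Φ₁ (g' y.1) y.2) x :=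
      (h.differentiableOn (by simp)).differentiableAt (hopen.mem_nhds ⟨Set.mem_univ _, hx2⟩)
    have hd1' : DifferentiableAt ℝ (fun y : (W → Fin 3 → ℝ) × ℝ => Φ₁ (g' y.1) y.2) (x.1, -x.2) :=
      (h.differentiableOn (by simp)).differentiableAt (hopen.mem_nhds ⟨Set.mem_univ _, hnegmem hx2⟩)
    have hd2 : DifferentiableAt ℝ (fun y : (W → Fin 3 → ℝ) × ℝ => Φ₁ (g' y.1) (-y.2)) x := by
      have h2 := hd1'.comp x (hN x).differentiableAt
      exact h2
    have hchain : fderiv ℝ (fun y : (W → Fin 3 → ℝ) × ℝ => Φ₁ (g' y.1) (-y.2)) x (v, 0) =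
        fderiv ℝ (fun y : (W → Fin 3 → ℝ) × ℝ => Φ₁ (g' y.1) y.2) (x.1, -x.2) (v, 0) := by
      have hc := (hd1'.hasFDerivAt.comp x (hN x)).fderiv
      rw [show (fun y : (W → Fin 3 → ℝ) × ℝ => Φ₁ (g' y.1) (-y.2)) = (fun y : (W → Fin 3 → ℝ) × ℝ => Φ₁ (g' y.1) y.2) ∘ (fun z : (W → Fin 3 → ℝ) × ℝ => (z.1, -z.2)) from rfl, hc]
      simp
    rw [fderiv_fun_sub hd1 hd2, sub_apply, hchain,
      fderiv_cayley_orbitalIntegral_param_prod_apply hJ μ z Φ₁ hΦ₁ g' hg' hgc' v hx2,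
      fderiv_cayley_orbitalIntegral_param_prod_apply hJ μ z Φ₁ hΦ₁ g' hg' hgc' v (x := (x.1, -x.2)) (hnegmem hx2)]
  · -- `h1₂`: joint smoothness of the split reader everywhere (★ p851042)
    rintro g' ⟨hg', hgc'⟩
    exact (contDiff_splitIntegral_param hJ κK μN hK θ Φ₂ hΦ₂ g' hg' hgc').contDiffOn
  · -- `h2₂`: the split reader differentiates its family (★ p851143, joint form)
    rintro g' ⟨hg', hgc'⟩ v x _
    exact fderiv_splitIntegral_param_prod_apply hJ κK μN hK θ Φ₂ hΦ₂ g' hg' hgc' v x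

end Literature.NumberTheory.Rogawski1990

end
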